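import Summits.Ventures.LatticeQCDFlow.Exactness.FlowAcceptanceOverlap
import HarnessLib

/-!
# The flow sampler's acceptance is bounded below by its ESS fraction: `m ≥ κ/(1+κ)`, `ā ≥ (κ/(1+κ))²`

HONEST FRAMING: exact (Metropolis-corrected) sampling algorithms for lattice gauge theory;
figures of merit are autocorrelation/cost numbers at stated couplings and volumes; no
continuum-physics claim.  (SCALAR calibration rung S0-A: not a gauge result.)

Venture `LatticeQCDFlow` (cell pub-lqcd), topic `Exactness`; FANOUT row 2 (`s0-phi4`, FLOW arm:
the acceptance and ESS columns of the flow sampler).  NEW WORK of the cell (a pointwise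
harmonic-mean bound and a tangent-line Jensen step over Mathlib), composing row 2's
`FlowAcceptanceOverlap.lean` (`m² ≤ ā ≤ m`, `m = ∫ min(p, q) = 1 − TV`).  Nothing is cited as a
fact.

## What is proved (`(X, μ)` s-finite; probability densities `p, q > 0`; `b = p/q` the importance
weight, `W = ∫ b p dμ = E_q[b²] = 1/κ` with `κ` the Kish effective-sample-size fraction;
`m = ∫ min(p, q)`, `ā = ∫∫ min(p(x)q(y), p(y)q(x))` the equilibrium acceptance)

* `min_ge_div_one_add_weight` — pointwise `min(p, q) ≥ p/(1 + b)` (harmonic mean ≤ min);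
* `inv_one_add_tangent` — convexity of `x ↦ 1/(1+x)`: `1/(1+x) ≥ 1/(1+W) − (x − W)/(1+W)²`;
* **`overlap_ge_of_weightMoment`** — `m ≥ 1/(1 + W) = κ/(1 + κ)` (Jensen under `p`,
  `E_p[b] = W`);
* **`meanAccept_ge_of_weightMoment`** — `ā ≥ (1/(1 + W))² = (κ/(1+κ))² ≥ κ²/4`;
* the lattice (`p = e^{−S}/Z`, row 2's flow sampler): **`phi4Flow_meanAccept_ge_of_weightMoment`**.

Reading for S0-A and the exactness battery (no numerics implied): a flow arm that reports an
ESS fraction `κ̂` and an equilibrium acceptance `ā̂` must satisfy `ā ≥ (κ/(1+κ))²` up to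
statistical error — a model-free consistency check between the two most-reported flow
diagnostics, alongside `1 − √ā ≤ TV ≤ 1 − ā` (`FlowAcceptanceOverlap`) and
`τ_int ≤ ½ + 12 (B²/E[g²])/κ` (`IMHTauIntLeInvESS`).  NOT CLAIMED: any upper bound on `ā` in
terms of `κ` alone; anything out of equilibrium; any number for a trained network.
-/

namespace Summit.Ventures.LatticeQCDFlow.Exactness

open Real MeasureTheory Filter

section General

variable {X : Type*} [MeasurableSpace X] {μ : Measure X} {p q : X → ℝ}

omit [MeasurableSpace X] in
/-- **Harmonic mean ≤ min**: `min(p, q) ≥ p/(1 + p/q)` for `p, q > 0`. -/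
theorem min_ge_div_one_add_weight (hp0 : ∀ x, 0 < p x) (hq0 : ∀ x, 0 < q x) (x : X) :
    p x / (1 + p x / q x) ≤ min (p x) (q x) := by
  have hp := hp0 x
  have hq := hq0 x
  have h1 : 0 < 1 + p x / q x := by positivity
  refine le_min ?_ ?_
  · rw [div_le_iff₀ h1]
    nlinarith [div_nonneg hp.le hq.le]
  · rw [div_le_iff₀ h1]
    have e : q x * (1 + p x / q x) = q x + p x := by
      field_simp
    rw [e]
    linarith

/-- Convexity of `x ↦ 1/(1 + x)` on `[0, ∞)` as a tangent-line inequality at `W ≥ 0`: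
`1/(1 + x) ≥ 1/(1 + W) − (x − W)/(1 + W)²`. -/
theorem inv_one_add_tangent {x W : ℝ} (hx : 0 ≤ x) (hW : 0 ≤ W) :
    1 / (1 + W) - (x - W) / (1 + W) ^ 2 ≤ 1 / (1 + x) := by
  have h1 : 0 < 1 + x := by linarith
  have h2 : 0 < 1 + W := by linarith
  rw [div_sub_div _ _ h2.ne' (pow_pos h2 2).ne', div_le_div_iff₀ (mul_pos h2 (pow_pos h2 2)) h1]
  nlinarith [sq_nonneg (x - W), mul_pos h2 (pow_pos h2 2)]

variable [SFinite μ]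

omit [SFinite μ] in
/-- **OVERLAP ≥ ESS FRACTION / (1 + ESS FRACTION)**: for probability densities `p, q > 0` with
`W = ∫ (p/q) p dμ < ∞` (`= E_q[(p/q)²] = 1/κ`): `∫ min(p, q) dμ ≥ 1/(1 + W) = κ/(1 + κ)`. -/
theorem overlap_ge_of_weightMoment (hp0 : ∀ x, 0 < p x) (hpi : Integrable p μ)
    (hp1 : ∫ x, p x ∂μ = 1) (hq0 : ∀ x, 0 < q x) (hqi : Integrable q μ)
    (hW : Integrable (fun x => p x / q x * p x) μ) :
    1 / (1 + ∫ x, p x / q x * p x ∂μ) ≤ ∫ x, min (p x) (q x) ∂μ := by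
  set W : ℝ := ∫ x, p x / q x * p x ∂μ with hWdef
  have hW0 : 0 ≤ W := integral_nonneg fun x =>
    mul_nonneg (div_nonneg (hp0 x).le (hq0 x).le) (hp0 x).le
  have h1W : 0 < 1 + W := by linarith
  -- the tangent minorant `p (1/(1+W) − (b − W)/(1+W)²)` integrates to `1/(1+W)`
  have hlin : Integrable (fun x => p x * (1 / (1 + W) - (p x / q x - W) / (1 + W) ^ 2)) μ := by
    have e : (fun x => p x * (1 / (1 + W) - (p x / q x - W) / (1 + W) ^ 2))
        = fun x => (1 / (1 + W) + W / (1 + W) ^ 2) * p x - (1 / (1 + W) ^ 2) * (p x / q x * p x) := by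
      funext x; ring
    rw [e]
    exact (hpi.const_mul _).sub (hW.const_mul _)
  have hval : ∫ x, p x * (1 / (1 + W) - (p x / q x - W) / (1 + W) ^ 2) ∂μ = 1 / (1 + W) := by
    have e : ∀ x, p x * (1 / (1 + W) - (p x / q x - W) / (1 + W) ^ 2)
        = (1 / (1 + W) + W / (1 + W) ^ 2) * p x - (1 / (1 + W) ^ 2) * (p x / q x * p x) := by
      intro x; ring
    simp_rw [e]
    rw [integral_sub (hpi.const_mul _) (hW.const_mul _), integral_const_mul, integral_const_mul,
      hp1, ← hWdef]
    field_simp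
    ring
  rw [← hval]
  refine integral_mono hlin (hpi.inf hqi) fun x => ?_
  -- `p · tangent ≤ p/(1+b) ≤ min(p, q)`
  have hb0 : 0 ≤ p x / q x := div_nonneg (hp0 x).le (hq0 x).le
  calc p x * (1 / (1 + W) - (p x / q x - W) / (1 + W) ^ 2)
      ≤ p x * (1 / (1 + p x / q x)) :=
        mul_le_mul_of_nonneg_left (inv_one_add_tangent hb0 hW0) (hp0 x).le
    _ = p x / (1 + p x / q x) := by rw [mul_one_div]
    _ ≤ min (p x) (q x) := min_ge_div_one_add_weight hp0 hq0 x

/-- **EQUILIBRIUM ACCEPTANCE ≥ (κ/(1+κ))²**: for probability densities `p, q > 0` with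
`W = ∫ (p/q) p dμ < ∞`, the exact flow sampler's equilibrium acceptance satisfies
`ā = ∫∫ min(p(x)q(y), p(y)q(x)) ≥ (1/(1 + W))²` (overlap bound squared, `m² ≤ ā`). -/
theorem meanAccept_ge_of_weightMoment (hp0 : ∀ x, 0 < p x) (hpm : Measurable p)
    (hpi : Integrable p μ) (hp1 : ∫ x, p x ∂μ = 1) (hq0 : ∀ x, 0 < q x) (hqm : Measurable q)
    (hqi : Integrable q μ) (hq1 : ∫ x, q x ∂μ = 1)
    (hW : Integrable (fun x => p x / q x * p x) μ) :
    (1 / (1 + ∫ x, p x / q x * p x ∂μ)) ^ 2 ≤ ∫ x, ∫ y, min (p x * q y) (p y * q x) ∂μ ∂μ := by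
  have h0 : 0 ≤ 1 / (1 + ∫ x, p x / q x * p x ∂μ) := by
    refine div_nonneg zero_le_one ?_
    have : 0 ≤ ∫ x, p x / q x * p x ∂μ := integral_nonneg fun x =>
      mul_nonneg (div_nonneg (hp0 x).le (hq0 x).le) (hp0 x).le
    linarith
  exact (pow_le_pow_left₀ h0 (overlap_ge_of_weightMoment hp0 hpi hp1 hq0 hqi hW) 2).trans
    (overlap_sq_le_meanAccept (fun x => (hp0 x).le) hpm hpi (fun x => (hq0 x).le) hqm hqi hq1)

end General

/-! ## The lattice φ⁴ flow sampler -/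

section Lattice

open Summit.Ventures.LatticeQCDFlow.Scoring

variable {n : ℕ}

/-- **ACCEPTANCE ≥ (κ/(1+κ))² FOR THE φ⁴ FLOW SAMPLER.**  `λ > 0`, any real `J`; model density
`q̃ > 0` measurable with `∫ q̃ = 1`; target density `p = e^{−S}/Z`; if the normalised second weight
moment `W = ∫ (p/q̃) p dφ` is finite, then `∫ min(p, q̃) ≥ 1/(1 + W)` and the equilibrium
acceptance `ā = ∫∫ min(p(φ)q̃(φ'), p(φ')q̃(φ)) ≥ (1/(1 + W))²`. -/
theorem phi4Flow_meanAccept_ge_of_weightMoment {lam : ℝ} (hlam : 0 < lam)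
    (J : Fin (n + 1) → Fin (n + 1) → ℝ) {q : (Fin (n + 1) → ℝ) → ℝ} (hq0 : ∀ φ, 0 < q φ)
    (hqm : Measurable q) (hqi : Integrable q) (hq1 : ∫ φ, q φ = 1)
    (hW : Integrable (fun φ => (gibbsWeight J lam φ / gibbsZ J lam) / q φ
      * (gibbsWeight J lam φ / gibbsZ J lam))) :
    1 / (1 + ∫ φ, (gibbsWeight J lam φ / gibbsZ J lam) / q φ * (gibbsWeight J lam φ / gibbsZ J lam))
        ≤ ∫ φ, min (gibbsWeight J lam φ / gibbsZ J lam) (q φ)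
    ∧ (1 / (1 + ∫ φ, (gibbsWeight J lam φ / gibbsZ J lam) / q φ
          * (gibbsWeight J lam φ / gibbsZ J lam))) ^ 2
        ≤ ∫ φ, ∫ φ', min (gibbsWeight J lam φ / gibbsZ J lam * q φ')
            (gibbsWeight J lam φ' / gibbsZ J lam * q φ) := by
  have hZ := gibbsZ_pos hlam J
  have hp0 : ∀ φ, 0 < gibbsWeight J lam φ / gibbsZ J lam := fun φ =>
    div_pos (gibbsWeight_pos J lam φ) hZ
  have hpm : Measurable fun φ => gibbsWeight J lam φ / gibbsZ J lam :=
    (continuous_gibbsWeight J lam).measurable.div_const _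
  have hpi : Integrable fun φ => gibbsWeight J lam φ / gibbsZ J lam :=
    (integrable_gibbsWeight hlam J).div_const _
  have hp1 : ∫ φ, gibbsWeight J lam φ / gibbsZ J lam = 1 := by
    rw [integral_div]
    unfold gibbsZ
    exact div_self (by unfold gibbsZ at hZ; exact hZ.ne')
  exact ⟨overlap_ge_of_weightMoment hp0 hpi hp1 hq0 hqi hW,
    meanAccept_ge_of_weightMoment hp0 hpm hpi hp1 hq0 hqm hqi hq1 hW⟩

end Lattice

end Summit.Ventures.LatticeQCDFlow.Exactness
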